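import Summits.HodgeConjecture.HodgeConjecture.Theorems.MarkmanPartnerTransportPartnerExistenceK3Side
import Summits.HodgeConjecture.HodgeConjecture.Theorems.MarkmanPartnerTransportPartnerExistencePositiveVector
import Literature.AlgebraicGeometry.HodgeTheory.HodgeModelExistence

/-!
# Route MarkmanPartnerTransport · support `PartnerExistence` (stmt-HodgeConjecture-19655) —
# the K3 partner from a GIVEN isometric embedding `T(X)_ℚ ↪ Λ_{K3} ⊗ ℚ` (Hasse–Minkowski-free form)

`partnerExistence_explicit` (`…PartnerExistenceOfPeriodSurjective`, prover 19652-p1 g5) builds a K3 partner of a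
marked `K3^{[2]}`-type fourfold `(X, φ, P, z)` with `ρ(X) ≥ 4` in two steps: (HM) Hasse–Minkowski embeds the
rational transcendental space `(T_ℚ, q)` isometrically into `Λ_{K3} ⊗ ℚ` (`exists_isometry_ratTransc`, the ONLY
use of `ρ(X) ≥ 4` besides the final Picard count); (P) period transport + positive vector + surjectivity of the
period map + the marking calculus give `(S, η, p, x, g)`. This file isolates (P):

* `partnerExistence_of_ratTransc_isometry` — **given an injective isometry `f : (T_ℚ, q) →qᵢ (ℚ²², k3FormRat)`,
  a projective K3 partner `(S, η, p, x, g)` with (g1)–(g7) exists and `ρ(X) ≤ ρ(S) + 1`**, modulo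
  `Huybrechts_K3_periodSurjective_projective` only; NO hypothesis on `ρ(X)`.

The body is the g5 proof verbatim (two edits: `f` is a hypothesis; the last clause is the general Picard
bound). Consumer: `…PartnerOfMinusTwoClass` (X3a of memo ROUTE-P1AI §D3′: at `ρ(X) = 3` the embedding exists iff
`NS(X)_ℚ` represents `−2`, by one reflection — no Hasse–Minkowski). No definition, no sorry, no new named
fact. Prover seat hodge-nonav-19716-p2 (gen 4), `--supports stmt-HodgeConjecture-19655`.

References: D. Huybrechts, *Lectures on K3 Surfaces*, Ch. 6 Thm. 3.1 / Rem. 3.3, Ch. 7 Thm. 4.1, Ch. 1 §3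
and Prop. 3.5, Ch. 3 §2; D. Morrison, Invent. Math. 75 (1984) §1–2; E. Markman, J. reine angew. Math. (2024) §1.3.
-/

noncomputable section

set_option linter.dupNamespace false

open scoped Matrix
open Module CategoryTheory
open Literature.AlgebraicTopology.SingularHomology Literature.Geometry.Kaehler
open Literature.AlgebraicGeometry Literature.AlgebraicGeometry.Motives Literature.AlgebraicGeometry.HodgeTheory
open Literature.AlgebraicGeometry.Hyperkaehler Literature.AlgebraicGeometry.Surfaces
open Summit.HodgeConjecture.HodgeConjecture.Theorems.NikulinTwinTransport
open Summit.HodgeConjecture.HodgeConjecture.Theorems.AnchorExistenceCMFloor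
open Summit.HodgeConjecture.HodgeConjecture.Theorems.MarkmanPartnerTransport.BBFPositivity

namespace Summit.HodgeConjecture.HodgeConjecture.Theorems.MarkmanPartnerTransport.PartnerLattice

/-- `MarkedK3Sq[X, φ, P, z]`: VERBATIM the `let MarkedK3Sq := …` binder of the route declarations of
MarkmanPartnerTransport (clauses (m1)–(m6)). Local notation only. -/
local notation3 (prettyPrint := false) "MarkedK3Sq[" X ", " φ ", " P ", " z "]" =>
  (((IsIntegralClass P ∧ ∀ Q : complexBetti X (2 * 4), IsIntegralClass Q → ∃ n : ℤ, Q = n • P) ∧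
    (∀ c : complexBetti X 2, IsIntegralClass c ↔ ∃ v : K3HilbertIndex → ℤ, φ c = fun i => (v i : ℂ)) ∧
    (∀ a : complexBetti X 2, cupPowTwo a 4 = ((3 : ℂ) * (k3HilbertForm 2 (φ a) (φ a)) ^ 2) • P) ∧
    (IsOfHodgeType 4 X 2 2 0 (LinearEquiv.symm φ z) ∧
      ∀ τ : complexBetti X 2, IsOfHodgeType 4 X 2 2 0 τ → ∃ t : ℂ, τ = t • LinearEquiv.symm φ z) ∧
    (∀ c : complexBetti X 2, IsOfHodgeType 4 X 2 1 1 c ↔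
      (k3HilbertForm 2 (φ c) z = 0 ∧ k3HilbertForm 2 (φ c) (star z) = 0)) ∧
    (k3HilbertForm 2 z z = 0 ∧ 0 < (k3HilbertForm 2 (star z) z).re)))

/-- `qQ` = the rational Beauville–Bogomolov form of `K3^{[2]}`-type on `ℚ²³`. Local notation only. -/
local notation3 (prettyPrint := false) "qQ" => Matrix.toBilin' (Matrix.map (k3HilbertGram 2) (Int.cast : ℤ → ℚ))

/-- `cx[F]` = the complexification of a `ℚ`-linear `F : ℚ²³ → ℚ²²`. Local notation only. -/
local notation3 (prettyPrint := false) "cx[" F "]" =>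
  Matrix.toLin' (Matrix.map (LinearMap.toMatrix' (R := ℚ) F) (Rat.cast : ℚ → ℂ))

/-- `cy[G]` = the complexification of a `ℚ`-linear `G : ℚ²² → ℚ²³`. Local notation only. -/
local notation3 (prettyPrint := false) "cy[" G "]" =>
  Matrix.toLin' (Matrix.map (LinearMap.toMatrix' (R := ℚ) G) (Rat.cast : ℚ → ℂ))

/-! ### The partner from an embedding -/

/-- **A K3 partner from an isometric embedding `T(X)_ℚ ↪ Λ_{K3} ⊗ ℚ`** (the Hasse–Minkowski-FREE half of
`partnerExistence_explicit`): for a marked smooth projective fourfold `(X, φ, P, z)`, a rational Néron–Severi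
space `NQ` (characterised by `hNQ`) and an INJECTIVE ISOMETRY `f : (T_ℚ, q) → (ℚ²², k3FormRat)` of the rational
transcendental space `T_ℚ = NQ^⊥`, there are a projective K3 surface `S`, a marking `(η, p, x)` with the full
marking ∕ projectivity clauses, and `g : H²(S) → H²(X)` with (g1)–(g7) (rational, Hodge, kills `N¹(S)`, image in
and onto `T(X)_ℂ`, isometric on cup-transcendental classes, rational lifts), and `ρ(X) ≤ ρ(S) + 1`. The proof is
VERBATIM that of `partnerExistence_explicit` (prover 19652-p1 g5) with the embedding taken as a hypothesis in
place of `exists_isometry_ratTransc` (Hasse–Minkowski, `ρ(X) ≥ 4`) and the Picard bound stated in general.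
Modulo `Huybrechts_K3_periodSurjective_projective` only. [cite: Huybrechts2016K3, Ch. 6 Thm. 3.1, Ch. 7 Thm. 4.1]
[cite: Morrison1984, §1–2] -/
theorem partnerExistence_of_ratTransc_isometry (hP : Huybrechts_K3_periodSurjective_projective)
    {X : SchemeOver ℂ} (hX : IsSmoothProjective 4 X)
    {φ : complexBetti X 2 ≃ₗ[ℂ] (K3HilbertIndex → ℂ)} {P : complexBetti X (2 * 4)} {z : K3HilbertIndex → ℂ}
    (hM : MarkedK3Sq[X, φ, P, z]) {NQ : Submodule ℚ (K3HilbertIndex → ℚ)}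
    (hNQ : ∀ v, v ∈ NQ ↔ φ.symm (fun i => (v i : ℂ)) ∈ algebraicClasses X 1)
    (f : ((qQ).restrict ((qQ).orthogonal NQ)).toQuadraticMap →qᵢ k3FormRat.toQuadraticMap)
    (hf : Function.Injective f) :
    ∃ (S : SchemeOver ℂ) (η : complexBetti S (2 * 1) ≃ₗ[ℂ] (K3Index → ℂ)) (p : complexBetti S (2 * 2))
      (x : K3Index → ℂ) (g : complexBetti S (2 * 1) →ₗ[ℂ] complexBetti X 2),
      IsK3Surface S ∧
      (p ≠ 0 ∧ (IsIntegralClass p ∧ (∀ q : complexBetti S (2 * 2), IsIntegralClass q → ∃ n : ℤ, q = n • p) ∧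
        (∀ c : complexBetti S (2 * 1), IsIntegralClass c ↔ ∃ v : K3Index → ℤ, η c = fun i => (v i : ℂ)) ∧
        (∀ a b : complexBetti S (2 * 1), cupProduct (rfl : 2 * 1 + 2 * 1 = 2 * 2) a b = k3Form (η a) (η b) • p) ∧
        IsOfHodgeType 2 S (2 * 1) 2 0 (LinearEquiv.symm η x) ∧
        (∀ τ : complexBetti S (2 * 1), IsOfHodgeType 2 S (2 * 1) 2 0 τ → ∃ t : ℂ, τ = t • LinearEquiv.symm η x)) ∧
        (k3Form x x = 0 ∧ 0 < (k3Form (star x) x).re ∧ ∃ u : K3Index → ℤ,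
          k3Form (fun i => (u i : ℂ)) x = 0 ∧ 0 < ∑ i, ∑ j, u i * k3Gram i j * u j)) ∧
      ((∀ a, IsRationalClass a → IsRationalClass (g a)) ∧
        (∀ (i j : ℕ) a, IsOfHodgeType 2 S (2 * 1) i j a → IsOfHodgeType 4 X 2 i j (g a)) ∧
        (∀ d ∈ algebraicClasses S 1, g d = 0) ∧
        (∀ a, ∀ d : complexBetti X 2, d ∈ algebraicClasses X 1 → k3HilbertForm 2 (φ (g a)) (φ d) = 0) ∧
        (∀ a b, (∀ d ∈ algebraicClasses S 1, cupProduct (rfl : 2 * 1 + 2 * 1 = 2 * 2) a d = 0) →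
          (∀ d ∈ algebraicClasses S 1, cupProduct (rfl : 2 * 1 + 2 * 1 = 2 * 2) b d = 0) →
          k3HilbertForm 2 (φ (g a)) (φ (g b)) = k3Form (η a) (η b)) ∧
        (∀ y, (∀ d : complexBetti X 2, d ∈ algebraicClasses X 1 → k3HilbertForm 2 (φ y) (φ d) = 0) →
          ∃ a, (∀ d ∈ algebraicClasses S 1, cupProduct (rfl : 2 * 1 + 2 * 1 = 2 * 2) a d = 0) ∧ g a = y) ∧
        (∀ y, (∀ d : complexBetti X 2, d ∈ algebraicClasses X 1 → k3HilbertForm 2 (φ y) (φ d) = 0) →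
          IsRationalClass y →
          ∃ a, (∀ d ∈ algebraicClasses S 1, cupProduct (rfl : 2 * 1 + 2 * 1 = 2 * 2) a d = 0) ∧
            IsRationalClass a ∧ g a = y)) ∧
      Module.finrank ℂ (algebraicClasses X 1) ≤ Module.finrank ℂ (algebraicClasses S 1) + 1 := by
  classical
  obtain ⟨-, hint, -, ⟨hz20, -⟩, h11, -⟩ := id hM
  -- the rational transcendental space `T_ℚ = NQ^⊥` and the GIVEN isometric embedding `f`
  have hc : IsCompl ((qQ).orthogonal NQ) NQ := (isCompl_ratNeronSeveri_orthogonal hX hM hNQ).symm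
  have hfinj : Function.Injective f.toLinearMap := fun a b h => hf h
  have hz : z ∈ Submodule.span ℂ ((fun a : K3HilbertIndex → ℚ => fun i => (a i : ℂ)) ''
      ((qQ).orthogonal NQ : Set (K3HilbertIndex → ℚ))) := period_mem_span_ratTransc hX hM hNQ
  -- `F = f ∘ pr_T`
  set F : (K3HilbertIndex → ℚ) →ₗ[ℚ] (K3Index → ℚ) :=
    f.toLinearMap ∘ₗ ((qQ).orthogonal NQ).projectionOnto NQ hc with hFdef
  have hFt : ∀ t (ht : t ∈ (qQ).orthogonal NQ), F t = f ⟨t, ht⟩ := fun t ht => by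
    rw [hFdef, LinearMap.comp_apply, Submodule.projectionOnto_apply_of_mem_left hc ht]
    rfl
  have hF : ∀ t ∈ (qQ).orthogonal NQ, ∀ t' ∈ (qQ).orthogonal NQ, k3FormRat (F t) (F t') = qQ t t' := by
    intro t ht t' ht'
    rw [hFt t ht, hFt t' ht']
    exact isometry_bilinear f ⟨t, ht⟩ ⟨t', ht'⟩
  -- `W = F(T_ℚ) = range f`, `M = W^⊥`
  set W : Submodule ℚ (K3Index → ℚ) := LinearMap.range f.toLinearMap with hWdef
  have hFW : ∀ v, F v ∈ W := fun v => ⟨_, rfl⟩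
  have hWc : IsCompl W (k3FormRat.orthogonal W) := by
    refine (LinearMap.BilinForm.restrict_nondegenerate_iff_isCompl_orthogonal k3FormRat_isSymm.isRefl).1
      (LinearMap.BilinForm.nondegenerate_restrict_of_disjoint_orthogonal _ k3FormRat_isSymm.isRefl
        (disjoint_iff.2 ?_))
    rw [eq_bot_iff]
    rintro w ⟨⟨t, rfl⟩, hwM⟩
    rw [Submodule.mem_bot]
    have ht0 : (t : K3HilbertIndex → ℚ) ∈ NQ ⊓ (qQ).orthogonal NQ := by
      refine Submodule.mem_inf.2 ⟨?_, t.2⟩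
      have htN : (t : K3HilbertIndex → ℚ) ∈ (qQ).orthogonal ((qQ).orthogonal NQ) := by
        rw [LinearMap.BilinForm.mem_orthogonal_iff]
        intro t' ht'
        show qQ t' t = 0
        rw [← isometry_bilinear f ⟨t', ht'⟩ t]
        exact (LinearMap.BilinForm.mem_orthogonal_iff.1 hwM) (f ⟨t', ht'⟩) ⟨_, rfl⟩
      rwa [orthogonal_ratTransc] at htN
    rw [ratNeronSeveri_inf_orthogonal_eq_bot hX hM hNQ, Submodule.mem_bot] at ht0
    have : t = 0 := Subtype.ext ht0
    rw [this, map_zero]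
  have hMW : ∀ m ∈ k3FormRat.orthogonal W, ∀ w ∈ W, k3FormRat m w = 0 := fun m hm w hw => by
    rw [k3FormRat_isSymm.eq]; exact (LinearMap.BilinForm.mem_orthogonal_iff.1 hm) w hw
  -- `G = f⁻¹ ∘ pr_W`
  set G : (K3Index → ℚ) →ₗ[ℚ] (K3HilbertIndex → ℚ) := ((qQ).orthogonal NQ).subtype ∘ₗ
    LinearMap.linearProjOfIsCompl (k3FormRat.orthogonal W) f.toLinearMap hfinj hWc with hGdef
  have hGf : ∀ t : (qQ).orthogonal NQ, G (f t) = t := fun t => by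
    rw [hGdef, LinearMap.comp_apply]
    have h := LinearMap.linearProjOfIsCompl_apply_left (k3FormRat.orthogonal W) f.toLinearMap hfinj hWc t
    rw [QuadraticMap.Isometry.coe_toLinearMap] at h
    rw [h]
    rfl
  have hGF : ∀ t ∈ (qQ).orthogonal NQ, G (F t) = t := fun t ht => by rw [hFt t ht, hGf]
  have hGT : ∀ v, G v ∈ (qQ).orthogonal NQ := fun v => by
    rw [hGdef, LinearMap.comp_apply]
    exact Submodule.coe_mem _
  have hGM : ∀ m ∈ k3FormRat.orthogonal W, G m = 0 := fun m hm => by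
    rw [hGdef, LinearMap.comp_apply, LinearMap.linearProjOfIsCompl_apply_right' _ _ _ _ m hm, map_zero]
  have hG : ∀ w ∈ W, ∀ w' ∈ W, qQ (G w) (G w') = k3FormRat w w' := by
    rintro _ ⟨t, rfl⟩ _ ⟨t', rfl⟩
    rw [QuadraticMap.Isometry.coe_toLinearMap, hGf, hGf]
    exact (isometry_bilinear f t t').symm
  have hFGM : ∀ v, v - F (G v) ∈ k3FormRat.orthogonal W := by
    intro v
    have hvtop : v ∈ W ⊔ k3FormRat.orthogonal W := by rw [hWc.sup_eq_top]; exact Submodule.mem_top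
    obtain ⟨_, ⟨t, rfl⟩, m, hm, rfl⟩ := Submodule.mem_sup.1 hvtop
    rw [map_add, hGM m hm, add_zero, QuadraticMap.Isometry.coe_toLinearMap, hGf, hFt _ t.2]
    simpa using hm
  -- the transported period
  obtain ⟨hxx, hxpos⟩ := period_transport hX hM hNQ F hF
  have hxW : cx[F] z ∈ Submodule.span ℂ ((fun a : K3Index → ℚ => fun i => (a i : ℂ)) '' (W : Set (K3Index → ℚ))) :=
    cplx_mem_span F W hFW z
  have hxbarW : star (cx[F] z) ∈
      Submodule.span ℂ ((fun a : K3Index → ℚ => fun i => (a i : ℂ)) '' (W : Set (K3Index → ℚ))) := by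
    rw [← cplx_star]
    exact cplx_mem_span F W hFW (star z)
  have hirr : ∀ w ∈ W, k3Form (fun i => (w i : ℂ)) (cx[F] z) = 0 → w = 0 := by
    rintro _ ⟨t, rfl⟩ h
    rw [QuadraticMap.Isometry.coe_toLinearMap] at h ⊢
    rw [← hFt _ t.2, ← cplx_ratCast F, k3Form_cx_cx F _ hF (Submodule.subset_span ⟨_, t.2, rfl⟩) hz] at h
    have ht := eq_zero_of_mem_ratTransc_of_orthogonal_period hX hM hNQ t.2 h
    rw [show t = 0 from Subtype.ext ht, map_zero]
  have hGx : cy[G] (cx[F] z) = z := cplx_cplx_of_mem_span F G _ hGF hz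
  -- the positive vector and the period fact
  obtain ⟨u, huT, hupos⟩ := exists_pos_int_orthogonal hX hM hNQ F hF
  have hux : k3Form (fun i => (u i : ℂ)) (cx[F] z) = 0 := by
    rw [intCastVec_eq_ratCastVec]
    exact k3Form_ratCast_transportedPeriod hX hM hNQ F huT
  obtain ⟨S, hS, η, p, hpint, hpgen, hηint, hcup, h20, h20span⟩ := hP (cx[F] z) hxx hxpos ⟨u, hux, hupos⟩
  have hp0 : p ≠ 0 := by
    -- as `NikulinTwinTransport.generator_ne_zero` (not imported: theses cone of another route)
    obtain ⟨p₁, hp₁, hp₁int, -⟩ := hS.exists_isIntegralClass_generator_H4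
    obtain ⟨n, hn⟩ := hpgen p₁ hp₁int
    rintro rfl
    rw [smul_zero] at hn
    exact hp₁ hn
  -- `g = φ⁻¹ ∘ G_ℂ ∘ η`
  set g : complexBetti S (2 * 1) →ₗ[ℂ] complexBetti X 2 :=
    (φ.symm : (K3HilbertIndex → ℂ) →ₗ[ℂ] complexBetti X 2) ∘ₗ cy[G] ∘ₗ
      (η : complexBetti S (2 * 1) →ₗ[ℂ] (K3Index → ℂ)) with hgdef
  have hφg : ∀ a, φ (g a) = cy[G] (η a) := fun a => by
    rw [hgdef, LinearMap.comp_apply, LinearMap.comp_apply, LinearEquiv.coe_coe, LinearEquiv.coe_coe,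
      LinearEquiv.apply_symm_apply]
  -- `G_ℂ` kills `M ⊗ ℂ`
  have hGM' : ∀ y ∈ Submodule.span ℂ ((fun a : K3Index → ℚ => fun i => (a i : ℂ)) ''
      (k3FormRat.orthogonal W : Set (K3Index → ℚ))), cy[G] y = 0 := by
    intro y hy
    induction hy using Submodule.span_induction with
    | mem y' hy' =>
      obtain ⟨m, hm, rfl⟩ := hy'
      beta_reduce
      rw [cplx_ratCast, hGM m hm]
      funext i
      simp
    | zero => rw [map_zero]
    | add a b _ _ ha hb => rw [map_add, ha, hb, add_zero]
    | smul c a _ ha => rw [map_smul, ha, smul_zero]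
  -- `v - F_ℂ G_ℂ v ∈ M ⊗ ℂ`
  have hres : ∀ v : K3Index → ℂ, v - cx[F] (cy[G] v) ∈ Submodule.span ℂ
      ((fun a : K3Index → ℚ => fun i => (a i : ℂ)) '' (k3FormRat.orthogonal W : Set (K3Index → ℚ))) := by
    intro v
    have h := mem_span_of_forall_ratCast (LinearMap.id - cx[F] ∘ₗ cy[G]) (k3FormRat.orthogonal W)
      (fun w => ?_) v
    · simpa using h
    · rw [LinearMap.sub_apply, LinearMap.id_apply, LinearMap.comp_apply, cplx_ratCast, cplx_ratCast]
      have hcast : (fun i => ((w - F (G w)) i : ℂ)) = (fun i => (w i : ℂ)) - fun i => ((F (G w)) i : ℂ) := by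
        funext i
        simp [Rat.cast_sub]
      rw [← hcast]
      exact Submodule.subset_span ⟨_, hFGM w, rfl⟩
  -- the `(1,1)` transfer: `q(G_ℂ v, z) = (v . x)` and `q(G_ℂ v, z̄) = (v . x̄)`
  have h11key : ∀ v : K3Index → ℂ, ∀ y ∈ Submodule.span ℂ ((fun a : K3HilbertIndex → ℚ => fun i => (a i : ℂ)) ''
      ((qQ).orthogonal NQ : Set (K3HilbertIndex → ℚ))),
      cx[F] y ∈ Submodule.span ℂ ((fun a : K3Index → ℚ => fun i => (a i : ℂ)) '' (W : Set (K3Index → ℚ))) →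
      k3HilbertForm 2 (cy[G] v) y = k3Form v (cx[F] y) := by
    intro v y hy hFy
    rw [← k3Form_cx_cx F _ hF (cplx_mem_span G _ hGT v) hy]
    have hr := k3Form_eq_zero_of_mem_span W _ hMW (hres v) hFy
    have hsplit : k3Form v (cx[F] y) =
        k3Form (cx[F] (cy[G] v)) (cx[F] y) + k3Form (v - cx[F] (cy[G] v)) (cx[F] y) := by
      rw [← k3Form_add_left, add_sub_cancel]
    rw [hsplit, hr, add_zero]
  refine ⟨S, η, p, cx[F] z, g, hS, ⟨hp0, ⟨hpint, hpgen, hηint, hcup, h20, h20span⟩, hxx, hxpos, u, hux, hupos⟩,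
    ⟨?_, ?_, ?_, ?_, ?_, ?_, ?_⟩, ?_⟩
  · -- (g1) rationality
    intro a ha
    obtain ⟨w, hw⟩ := (isRationalClass_iff_of_marking hS η hηint a).1 ha
    exact (isRationalClass_iff_of_markedSq hX hint (g a)).2 ⟨G w, by rw [hφg, hw, cplx_ratCast]⟩
  · -- (g2) Hodge types
    intro i j a ha
    by_cases hij : i + j = 2 * 1
    · have hi : i ≤ 2 := by omega
      interval_cases i
      · have hj : j = 2 := by omega
        subst hj
        obtain ⟨t, rfl⟩ := (zeroTwo_iff_of_marking hS hηint h20 hxpos a).1 ha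
        rw [map_smul]
        refine IsOfHodgeType.smul ?_ t
        have hga : g (η.symm (star (cx[F] z))) = conjClass (ComplexPoints X) 2 (φ.symm z) := by
          apply φ.injective
          rw [hφg, LinearEquiv.apply_symm_apply, cplx_star, hGx, marking_conjClass hint,
            LinearEquiv.apply_symm_apply]
        rw [hga]
        exact hz20.conjClass hX
      · have hj : j = 1 := by omega
        subst hj
        obtain ⟨hax, haxbar⟩ := (oneOne_iff_of_marking hS hp0 hηint hcup h20 hxpos a).1 ha
        refine (h11 (g a)).2 ⟨?_, ?_⟩
        · rw [hφg, h11key (η a) z hz hxW]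
          exact hax
        · rw [hφg, h11key (η a) (star z) (star_period_mem_span_ratTransc hX hM hNQ) (by rw [cplx_star]; exact hxbarW),
            cplx_star]
          exact haxbar
      · have hj : j = 0 := by omega
        subst hj
        obtain ⟨t, rfl⟩ := h20span a ha
        rw [map_smul]
        refine IsOfHodgeType.smul ?_ t
        have hga : g (η.symm (cx[F] z)) = φ.symm z := by
          apply φ.injective
          rw [hφg, LinearEquiv.apply_symm_apply, hGx, LinearEquiv.apply_symm_apply]
        rw [hga]
        exact hz20
    · -- `a = 0` (as `NikulinTwinTransport.isOfHodgeType_eq_zero_of_add_ne`, not imported: theses cone)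
      have ha0 : a = 0 := by
        obtain ⟨A, hA⟩ := ha
        rw [(A.hodgePQ_eq_bot_iff (2 * 1) i j).2
            (Literature.NumberTheory.Transcendental.hodgePQ_eq_bot_of_ne (M := A.carrier) hij),
          Submodule.mem_bot] at hA
        exact A.pullback_injective (2 * 1) (by rw [hA, map_zero])
      rw [ha0, map_zero]
      exact isOfHodgeType_zero_of_isSmoothProjective nonempty_hodgeModel_holds hX 2 i j
  · -- (g3) `g` kills `N¹(S)`
    intro d hd
    apply φ.injective
    rw [hφg, map_zero]
    exact hGM' _ (eta_algebraic_mem_span_orthogonal hS hp0 hηint hcup h20 hxpos hWc hxW hirr hd)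
  · -- (g4) image in `T(X)_ℂ`
    intro a d hd
    rw [hφg]
    exact (mem_span_ratTransc_iff hX hint hNQ _).1 (cplx_mem_span G _ hGT (η a)) d hd
  · -- (g5) isometry on cup-transcendental classes
    intro a b ha hb
    rw [hφg, hφg]
    exact k3HilbertForm_cy_cy G W hG
      (eta_mem_span_of_cupTransc hS hp0 hηint hcup h20 hxpos hxW hxbarW ha)
      (eta_mem_span_of_cupTransc hS hp0 hηint hcup h20 hxpos hxW hxbarW hb)
  · -- (g6) onto `T(X)_ℂ`
    intro y hy
    have hyT := (mem_span_ratTransc_iff hX hint hNQ (φ y)).2 hy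
    refine ⟨η.symm (cx[F] (φ y)), ?_, ?_⟩
    · exact cupTransc_of_eta_mem_span hS hp0 hηint hcup h20 hxpos hWc hxW hirr
        (by rw [LinearEquiv.apply_symm_apply]; exact cplx_mem_span F W hFW (φ y))
    · apply φ.injective
      rw [hφg, LinearEquiv.apply_symm_apply, cplx_cplx_of_mem_span F G _ hGF hyT]
  · -- (g7) rational lifts
    intro y hy hyrat
    have hyT := (mem_span_ratTransc_iff hX hint hNQ (φ y)).2 hy
    obtain ⟨v, hv⟩ := (isRationalClass_iff_of_markedSq hX hint y).1 hyrat
    refine ⟨η.symm (cx[F] (φ y)), ?_, ?_, ?_⟩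
    · exact cupTransc_of_eta_mem_span hS hp0 hηint hcup h20 hxpos hWc hxW hirr
        (by rw [LinearEquiv.apply_symm_apply]; exact cplx_mem_span F W hFW (φ y))
    · exact (isRationalClass_iff_of_marking hS η hηint _).2
        ⟨F v, by rw [LinearEquiv.apply_symm_apply, hv, cplx_ratCast]⟩
    · apply φ.injective
      rw [hφg, LinearEquiv.apply_symm_apply, cplx_cplx_of_mem_span F G _ hGF hyT]
  · -- `ρ(S) ≥ dim M = ρ(X) - 1`
    have h1 := le_finrank_algebraicClasses_of_marking hS hp0 hηint hcup h20 hxpos hxW hxbarW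
    have h2 : finrank ℚ (k3FormRat.orthogonal W) = 22 - finrank ℚ W := by
      rw [LinearMap.BilinForm.finrank_orthogonal k3FormRat_nondegenerate, finrank_k3Rat]
    have h3 : finrank ℚ W = 23 - finrank ℂ (algebraicClasses X 1) := by
      rw [hWdef, LinearMap.finrank_range_of_inj hfinj, finrank_ratTransc hX hint hNQ]
    have h4 : finrank ℂ (algebraicClasses X 1) ≤ 23 := by
      rw [← finrank_ratNeronSeveri hX hint hNQ, ← finrank_rat23]
      exact Submodule.finrank_le NQ
    omega


end Summit.HodgeConjecture.HodgeConjecture.Theorems.MarkmanPartnerTransport.PartnerLattice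

end
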